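import Literature.AlgebraicGeometry.Motives.HodgeStructureLefschetzGroupQuaternionBlocks
import Literature.AlgebraicGeometry.Motives.HodgeStructureLefschetzGroupStandardContragredient
import HarnessLib

/-!
# Milne 1999 §2, types II and III on points: on the partner block `V_{σ₂}` the group `Aut(V_{σ₁}, φ_{2,σ₁})` acts by the
# CONTRAGREDIENT of its standard representation, WHICH IS ISOMORPHIC TO THE STANDARD REPRESENTATION — `β` interchanges
# the two blocks equivariantly and the twisted form `B = Q_K(·, β_K ·)` identifies `V_{σ₁}` with its own dual
# ("its representation on `V_{σ₂}` is the contragredient of the standard representation (which is isomorphic to the standard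
# representation)")

[topic AlgebraicGeometry/Motives]

Layer `Literature/AlgebraicGeometry/Motives`, lane `lit-hodgefound` (Track 2 foundations library; seat `lit-hodgefound-p34`,
generation 23, self-proposed row g23-#3 — the closing sentences of Milne's type II and type III paragraphs, listed under
"NOT here" in the seat's g23-#1 file `Motives/HodgeStructureLefschetzGroupStandardContragredient` ("the analogous closing
sentences for types II/III … the self-duality of `Sp`/`O` is not treated")). For a simple abelian variety of type II
(`E` a totally definite quaternion algebra over `F`, `L = F[α]`, `E = L·1 ⊕ L·β`) Milne writes `V_σ = V_{σ₁} ⊕ V_{σ₂}` along the two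
extensions `σ₁, σ₂` of `σ : F → k^al` to `L`, identifies `S(A)_{k^al}`'s factor `U(φ_{1,σ}) ∩ Sp(φ_{2,σ})` with `Sp(φ_{2,σ₁})` by
`γ ↦ γ|V_{σ₁}`, and closes: "The representation of `Sp(φ_{2,σ₁})` on `V_{σ₁}` is its standard representation, and its representation
on `V_{σ₂}` is the contragredient of the standard representation (which is isomorphic to the standard representation)" — and the
same words for type III with `O(φ_{2,σ₁})`. On `K`-points of the abstract polarized `ℚ`-Hodge structure this is the situation of the
seat's `Motives/HodgeStructureLefschetzGroupQuaternionBlocks` (`β ∈ E_φ` with `βι(a) = ι(σa)β`, `β² = ι(b)`, `b ≠ 0`; the twisted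
block forms `B_χ(x, y) = Q_K(x, β_K y)` = Milne's `φ_{2,σ₁}`; `S(H)(K) ≃* ∏_{s ∈ Φ} Aut(V_{K,τₛ}, B_{τₛ})`), read with the seat's
g23-#1 dualities (`Polarization.restrictBlockEquiv`, `Polarization.blockDuality`): (i) "contragredient" —
`γ|V_{K,τₛ∘σ} = ᵗ(γ|V_{K,τₛ})⁻¹` under `V_{K,τₛ∘σ} ≅ V_{K,τₛ}^∨` (g23-#1, every type); (ii) "isomorphic to the standard
representation" — `β_K : V_{K,τₛ} ⥲ V_{K,τₛ∘σ}` INTERTWINES the two blocks of every `γ ∈ S(H)(K)` (`β ∈ E_φ`), equivalently the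
`B_{τₛ}`-duality `V_{K,τₛ} ≅ V_{K,τₛ}^∨`, `x ↦ B_{τₛ}(·, x)`, carries the standard representation of `Aut(V_{K,τₛ}, B_{τₛ})` to its
contragredient. Definitions WITH BODIES (`Polarization.betaBlockEquiv`, `Polarization.twistedBlockDuality`) and theorems; no named
fact (net debt `0`).

## The source, verbatim

J. S. Milne, *Lefschetz classes on abelian varieties*, Duke Math. J. **96** (1999) 639–675 [Milne1999LefschetzClasses]
(held `paper:doi-10-1215-s0012-7094-99-09620-5`; Duke page = folio + 638), §2 p. 650 (p0012):
* (type II, L26–L36) "Let `σ₁, σ₂ : L → k^al` be the extensions of `σ` to `L`. Then `V_σ = V_{σ₁} ⊕ V_{σ₂}`, `V_{σᵢ} = V ⊗_{L,σᵢ} k^al`,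
  and (see 2.2) `γ ↦ γ|V_{σ₁}` identifies `U(φ_{1,σ}) ∩ Sp(φ_{2,σ})` with `Sp(φ_{2,σ₁})`. The representation of `Sp(φ_{2,σ₁})` on `V_{σ₁}`
  is its standard representation, and its representation on `V_{σ₂}` is the contragredient of the standard representation (which is
  isomorphic to the standard representation)."
* (type III, L55–L62) "`S(A)_{k^al} ≅ ∏ O(φ_{2,σ₁})` where the product is indexed by the embeddings `σ : F → k^al` of `F` into `k^al`
  and `σ₁` is an extension of `σ` to `L`. The representation of `O(φ_{2,σ₁})` on `V_{σ₁} = V(A) ⊗_{L,σ₁} k^al` is its standard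
  representation, and its representation on `V_{σ₂}` is the contragredient of the standard representation (which is isomorphic to the
  standard representation)."
* (p. 649 L21–L26, L57–L59) "there exists a basis `1, α, β, αβ` for `E` with `α² = a ∈ F` …, `β² = b ∈ F` …, `αβ = −βα`";
  "`E = L·1 ⊕ L·β`, and so we can write `φ(x, y) = φ₁(x, y) + φ₂(x, y)β`".

DICTIONARY. `L = F[α]` is the number field acting through `A : EndAction H F` (the file's `F`), `σ` its conjugation over
Milne's `F`, `V_{σ₁}, V_{σ₂}` the blocks `V_{K,τₛ}`, `V_{K,τₛ∘σ}`; `β_K` maps `V_{K,τₛ}` isomorphically onto `V_{K,τₛ∘σ}`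
(`EndAction.bijective_restrict_baseChange`: "`αβ = −βα`", `β² = b ≠ 0`); `φ_{2,σ₁}` is the twisted block form
`B_{τₛ}(x, y) = Q_K(x, β_K y)` (`Polarization.twistedBlockForm`); `Sp(φ_{2,σ₁})`/`O(φ_{2,σ₁})` on `K`-points is the isometry group
`Aut(V_{K,τₛ}, B_{τₛ}) = MatrixAlgAction.isometryCentralizer ∅ B_{τₛ}`, onto which `γ ↦ γ|V_{K,τₛ}` maps `S(H)(K)`
(`Polarization.lefschetzGroupBaseChangeEquivTwistedBlocks`). "Contragredient … isomorphic to the standard representation":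
`V_{σ₂} ≅ V_{σ₁}^∨` (g23-#1's `blockDuality`, by `Q_K`) and `V_{σ₁}^∨ ≅ V_{σ₁}` (`B_{τₛ}` is a nondegenerate INVARIANT form), the
composite being `β_K⁻¹` up to these dualities.

## What is PROVED

* §1 DEF **`Polarization.betaBlockEquiv … s : V_{K,τₛ} ≃ₗ[K] V_{K,τₛ∘σ}`** (`β_K` restricted; `coe_betaBlockEquiv_apply` rfl) and
  **`Polarization.betaBlockEquiv_restrictBlockEquiv`**: for `γ ∈ S(H)(K)` and `β ∈ E_φ`, `β_K ∘ γ|V_{K,τₛ} = γ|V_{K,τₛ∘σ} ∘ β_K` — the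
  representations of `S(H)(K)` on the two blocks of a pair are ISOMORPHIC (`betaBlockEquiv_symm_restrictBlockEquiv` for `β_K⁻¹`).
* §2 DEF **`Polarization.twistedBlockDuality … s : V_{K,τₛ} ≃ₗ[K] Dual_K V_{K,τₛ}`** (`x ↦ B_{τₛ}(·, x)`, `= β_K` followed by g23-#1's
  `blockDuality`; `twistedBlockDuality_apply`), **`Polarization.twistedBlockDuality_apply_of_mem_isometryCentralizer`**: for EVERY
  `g ∈ Aut(V_{K,τₛ}, B_{τₛ})` (Milne's `Sp(φ_{2,σ₁})(k^al)` / `O(φ_{2,σ₁})(k^al)`), `B♭(g x) = ᵗg⁻¹ (B♭ x)` — "the contragredient of the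
  standard representation (which is isomorphic to the standard representation)"; and **`Polarization.twistedBlockDuality_restrictBlockEquiv`**
  (the same for `γ|V_{K,τₛ}`, `γ ∈ S(H)(K)`).
* §3 (with the seat's `S(H)(K) ≃* ∏_{s ∈ Φ} Aut(V_{K,τₛ}, B_{τₛ})`) `Polarization.restrictBlockEquiv_eq_coe_lefschetzGroupBaseChangeEquivTwistedBlocks`
  (dictionary) and **`Polarization.blockDuality_restrictBlockEquiv_symm_twisted`**: for an ARBITRARY family
  `g ∈ ∏_{s ∈ Φ} Aut(V_{K,τₛ}, B_{τₛ})` and the unique `γ ∈ S(H)(K)` restricting to it, `γ` acts on `V_{K,τₛ∘σ} ≅ V_{K,τₛ}^∨` by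
  `ᵗ(g_s)⁻¹` — "its representation on `V_{σ₂}` is the contragredient of the standard representation" for the whole group
  `Aut(V_{σ₁}, φ_{2,σ₁})`; **`Polarization.betaBlockEquiv_symm_restrictBlockEquiv_symm_twisted`**: and `β_K⁻¹` carries it back to the
  standard action `g_s` — "(which is isomorphic to the standard representation)".

NOT here (honest): the algebraic groups `Sp(φ_{2,σ₁})`, `O(φ_{2,σ₁})` themselves (only their `K`-points `Aut(V_{K,τₛ}, B_{τₛ})`, with the
parity of `B_{τₛ}` recorded by the seat's `Polarization.twistedBlockForm_swap`); that `E_φ` IS a quaternion algebra `L·1 ⊕ L·β` over a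
totally real field (Albert) — hypotheses `hβF`, `hb`, `hβ2`, `hgen` as in the seat's types II/III file. HC is NOT proved; nothing here
claims a case of the Hodge conjecture.

## References

* [Milne1999LefschetzClasses] J. S. Milne, *Lefschetz classes on abelian varieties*, Duke Math. J. 96 (1999) 639–675 — §2
  Remark 2.2 (pp. 647–648), pp. 649–650 (types II and III).
* [Deligne1982HodgeCycles] P. Deligne, *Hodge cycles on abelian varieties*, LNM 900 (1982) — §4 (decomposition along the action of a
  CM field, the pairing of conjugate summands under a polarization).
-/

noncomputable section

open scoped TensorProduct
open Function Module

namespace Literature.AlgebraicGeometry.Motives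

open Literature.LinearAlgebra.Matrix (MatrixAlgAction.isometryCentralizer MatrixAlgAction.mem_isometryCentralizer_empty_iff)

namespace HodgeStructure

universe u uK

variable {V : Type u} [AddCommGroup V] [Module ℚ V] {n : ℤ} {H : HodgeStructure V n}
variable {F : Type*} [Field F] [NumberField F]
variable (K : Type uK) [Field K] [Algebra ℚ K] (A : EndAction H F) {S : Type*} (τ : S → (F →ₐ[ℚ] K))
variable (Q : Polarization H) (σ : F ≃ₐ[ℚ] F) (β : Module.End ℚ V)
variable [Fintype S] [Module.Finite ℚ V] (κ : S → S) (Φ : Finset S)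
variable (hτ : Injective τ) (hcard : Fintype.card S = finrank ℚ F)
  (hros : ∀ a v w, Q.form (A.ι a v) w = Q.form v (A.ι (σ a) w)) (hσ : ∀ a, σ (σ a) = a)
  (hκ : ∀ s, τ (κ s) = (τ s).comp (σ : F →ₐ[ℚ] F))
  (hΦ₁ : ∀ s, s ∈ Φ ∨ κ s ∈ Φ) (hΦ₂ : ∀ s ∈ Φ, κ s ∉ Φ)
variable (hβF : ∀ a, β * A.ι a = A.ι (σ a) * β) {b : F} (hb : b ≠ 0) (hβ2 : β * β = A.ι b)

/-! ## §1 `β_K : V_{K,τₛ} ⥲ V_{K,τₛ∘σ}` intertwines the two blocks of every `γ ∈ S(H)(K)` — "`V_σ = V_{σ₁} ⊕ V_{σ₂}`" with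
isomorphic actions -/

include hτ hcard hros hσ hκ hβF hb hβ2 in
/-- **`β_K : V_{K,τₛ} ⥲ V_{K,τₛ∘σ}`**, the restriction of `β_K` to a block (bijective onto the partner block: `βι(a) = ι(σa)β`,
`β² = ι(b)`, `b ≠ 0` — Milne's `β` with "`αβ = −βα`, `β² = b`" interchanging `V_{σ₁}` and `V_{σ₂}`).
[cite: Milne1999LefschetzClasses, §2 p. 649 L21–L26 ("αβ = −βα … β² = b") and p. 650 L26–L31 ("V_σ = V_{σ₁} ⊕ V_{σ₂}")] -/
def Polarization.betaBlockEquiv (s : S) :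
    A.eigenspaceBaseChange K (τ s) ≃ₗ[K] A.eigenspaceBaseChange K ((τ s).comp (σ : F →ₐ[ℚ] F)) :=
  LinearEquiv.ofBijective
    ((β.baseChange K).restrict (p := A.eigenspaceBaseChange K (τ s))
      (q := A.eigenspaceBaseChange K ((τ s).comp (σ : F →ₐ[ℚ] F)))
      fun _ hx => A.baseChange_apply_mem_eigenspaceBaseChange_comp K σ β hβF hσ hx)
    (EndAction.bijective_restrict_baseChange K A τ Q σ β κ hτ hcard hros hσ hκ hβF hb hβ2 s)

/-- `β_K|V_{K,τₛ} x = β_K x`. [cite: Milne1999LefschetzClasses, §2 p. 650 L26–L31] -/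
@[simp] theorem Polarization.coe_betaBlockEquiv_apply (s : S) (x : A.eigenspaceBaseChange K (τ s)) :
    ((Q.betaBlockEquiv K A τ σ β κ hτ hcard hros hσ hκ hβF hb hβ2 s x : A.eigenspaceBaseChange K ((τ s).comp (σ : F →ₐ[ℚ] F))) :
        K ⊗[ℚ] V) = β.baseChange K (x : K ⊗[ℚ] V) :=
  rfl

/-- **`β_K` intertwines the two blocks of `γ ∈ S(H)(K)`**: `β_K (γ|V_{K,τₛ} x) = γ|V_{K,τₛ∘σ} (β_K x)` for `β ∈ E_φ` (`γ`
commutes with `E_φ ⊗ K`) — the representations of `S(H)(K)` on `V_{σ₁}` and on `V_{σ₂}` are ISOMORPHIC ("which is isomorphic to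
the standard representation"). [cite: Milne1999LefschetzClasses, §2 p. 650 L33–L36 and §1 p. 644 L18 ("S(A)(R) = {γ ∈ C(A) ⊗_k R | γ†γ = 1}")] -/
theorem Polarization.betaBlockEquiv_restrictBlockEquiv (hβ : β ∈ H.endAlg) {γ : (K ⊗[ℚ] V) ≃ₗ[K] (K ⊗[ℚ] V)}
    (hγ : γ ∈ Q.lefschetzGroupBaseChange K) (s : S) (x : A.eigenspaceBaseChange K (τ s)) :
    Q.betaBlockEquiv K A τ σ β κ hτ hcard hros hσ hκ hβF hb hβ2 s (Q.restrictBlockEquiv K A hγ (τ s) x) =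
      Q.restrictBlockEquiv K A hγ ((τ s).comp (σ : F →ₐ[ℚ] F)) (Q.betaBlockEquiv K A τ σ β κ hτ hcard hros hσ hκ hβF hb hβ2 s x) :=
  Subtype.ext (by
    rw [Q.coe_betaBlockEquiv_apply K A τ σ β κ hτ hcard hros hσ hκ hβF hb hβ2, Q.coe_restrictBlockEquiv_apply K A hγ,
      Q.coe_restrictBlockEquiv_apply K A hγ, Q.coe_betaBlockEquiv_apply K A τ σ β κ hτ hcard hros hσ hκ hβF hb hβ2]
    exact (Q.apply_baseChange_of_mem_lefschetzGroupBaseChange K β hβ hγ (x : K ⊗[ℚ] V)).symm)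

/-- The same for `β_K⁻¹ : V_{K,τₛ∘σ} ⥲ V_{K,τₛ}`: `β_K⁻¹ (γ|V_{K,τₛ∘σ} y) = γ|V_{K,τₛ} (β_K⁻¹ y)` — "its representation on `V_{σ₂}` …
(which is isomorphic to the standard representation)", the isomorphism being `β_K⁻¹`.
[cite: Milne1999LefschetzClasses, §2 p. 650 L33–L36 (type II) and L60–L62 (type III)] -/
theorem Polarization.betaBlockEquiv_symm_restrictBlockEquiv (hβ : β ∈ H.endAlg) {γ : (K ⊗[ℚ] V) ≃ₗ[K] (K ⊗[ℚ] V)}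
    (hγ : γ ∈ Q.lefschetzGroupBaseChange K) (s : S) (y : A.eigenspaceBaseChange K ((τ s).comp (σ : F →ₐ[ℚ] F))) :
    (Q.betaBlockEquiv K A τ σ β κ hτ hcard hros hσ hκ hβF hb hβ2 s).symm
        (Q.restrictBlockEquiv K A hγ ((τ s).comp (σ : F →ₐ[ℚ] F)) y) =
      Q.restrictBlockEquiv K A hγ (τ s) ((Q.betaBlockEquiv K A τ σ β κ hτ hcard hros hσ hκ hβF hb hβ2 s).symm y) := by
  rw [LinearEquiv.symm_apply_eq, Q.betaBlockEquiv_restrictBlockEquiv K A τ σ β κ hτ hcard hros hσ hκ hβF hb hβ2 hβ hγ,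
    LinearEquiv.apply_symm_apply]

/-! ## §2 The `B_{τₛ}`-duality `V_{K,τₛ} ≅ V_{K,τₛ}^∨`, `x ↦ B_{τₛ}(·, x)`, carries the standard representation of
`Aut(V_{K,τₛ}, B_{τₛ})` to its contragredient — "(which is isomorphic to the standard representation)" -/

include hτ hcard hros hσ hκ hβF hb hβ2 in
/-- **The `B_{τₛ}`-duality `V_{K,τₛ} ≅ V_{K,τₛ}^∨`, `x ↦ B_{τₛ}(·, x) = Q_K(·, β_K x)`**: `β_K : V_{K,τₛ} ⥲ V_{K,τₛ∘σ}` followed by the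
`Q_K`-duality `V_{K,τₛ∘σ} ≅ V_{K,τₛ}^∨` of g23-#1 (Milne's `φ_{2,σ₁}` is nondegenerate: `V_{σ₁} ≅ V_{σ₁}^∨`).
[cite: Milne1999LefschetzClasses, §2 p. 650 L17–L21 ("φ_{2,i} is skew-symmetric … Sp(φ_{2,σ₁})") and L33–L36] -/
def Polarization.twistedBlockDuality (s : S) : A.eigenspaceBaseChange K (τ s) ≃ₗ[K] Module.Dual K (A.eigenspaceBaseChange K (τ s)) :=
  (Q.betaBlockEquiv K A τ σ β κ hτ hcard hros hσ hκ hβF hb hβ2 s).trans (Q.blockDuality K A τ σ κ hτ hcard hros hσ hκ s)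

/-- `twistedBlockDuality x v = B_{τₛ}(v, x) = Q_K(v, β_K x)`. [cite: Milne1999LefschetzClasses, §2 p. 649 L57–L59 ("φ(x, y) = φ₁(x, y) + φ₂(x, y)β")] -/
@[simp] theorem Polarization.twistedBlockDuality_apply (s : S) (x v : A.eigenspaceBaseChange K (τ s)) :
    Q.twistedBlockDuality K A τ σ β κ hτ hcard hros hσ hκ hβF hb hβ2 s x v = Q.twistedBlockForm K A β (τ s) v x :=
  rfl

/-- **"The contragredient of the standard representation (which is isomorphic to the standard representation)"**: for EVERY
`g ∈ Aut(V_{K,τₛ}, B_{τₛ})` — the `K`-points of Milne's `Sp(φ_{2,σ₁})` (type II) / `O(φ_{2,σ₁})` (type III) — the `B_{τₛ}`-duality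
carries the standard action `g` to the contragredient `ᵗg⁻¹`: `B♭(g x) = B♭(x) ∘ g⁻¹` (`B(v, gx) = B(g⁻¹v, x)` by invariance).
[cite: Milne1999LefschetzClasses, §2 p. 650 L33–L36 (type II) and L60–L62 (type III)] -/
theorem Polarization.twistedBlockDuality_apply_of_mem_isometryCentralizer (s : S)
    {g : A.eigenspaceBaseChange K (τ s) ≃ₗ[K] A.eigenspaceBaseChange K (τ s)}
    (hg : g ∈ MatrixAlgAction.isometryCentralizer (L := K) (W := A.eigenspaceBaseChange K (τ s))
      (∅ : Set (Module.End K (A.eigenspaceBaseChange K (τ s)))) (Q.twistedBlockForm K A β (τ s)))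
    (x : A.eigenspaceBaseChange K (τ s)) :
    Q.twistedBlockDuality K A τ σ β κ hτ hcard hros hσ hκ hβF hb hβ2 s (g x) =
      g.symm.dualMap (Q.twistedBlockDuality K A τ σ β κ hτ hcard hros hσ hκ hβF hb hβ2 s x) := by
  refine LinearMap.ext fun v => ?_
  rw [LinearEquiv.dualMap_apply, Q.twistedBlockDuality_apply K A τ σ β κ hτ hcard hros hσ hκ hβF hb hβ2,
    Q.twistedBlockDuality_apply K A τ σ β κ hτ hcard hros hσ hκ hβF hb hβ2]
  have h := (MatrixAlgAction.mem_isometryCentralizer_empty_iff _ _).1 hg (g.symm v) x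
  rwa [g.apply_symm_apply] at h

/-- **For `γ ∈ S(H)(K)`: `B♭(γ|V_{K,τₛ} x) = ᵗ(γ|V_{K,τₛ})⁻¹ (B♭ x)`** — the standard action of `γ` on `V_{σ₁}` is carried by the
`B_{τₛ}`-duality to its contragredient (`β_K` intertwines, then g23-#1's `blockDuality_restrictBlockEquiv`).
[cite: Milne1999LefschetzClasses, §2 p. 650 L33–L36 and L60–L62] -/
theorem Polarization.twistedBlockDuality_restrictBlockEquiv (hβ : β ∈ H.endAlg) {γ : (K ⊗[ℚ] V) ≃ₗ[K] (K ⊗[ℚ] V)}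
    (hγ : γ ∈ Q.lefschetzGroupBaseChange K) (s : S) (x : A.eigenspaceBaseChange K (τ s)) :
    Q.twistedBlockDuality K A τ σ β κ hτ hcard hros hσ hκ hβF hb hβ2 s (Q.restrictBlockEquiv K A hγ (τ s) x) =
      (Q.restrictBlockEquiv K A hγ (τ s)).symm.dualMap (Q.twistedBlockDuality K A τ σ β κ hτ hcard hros hσ hκ hβF hb hβ2 s x) := by
  show Q.blockDuality K A τ σ κ hτ hcard hros hσ hκ s
      (Q.betaBlockEquiv K A τ σ β κ hτ hcard hros hσ hκ hβF hb hβ2 s (Q.restrictBlockEquiv K A hγ (τ s) x)) =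
    (Q.restrictBlockEquiv K A hγ (τ s)).symm.dualMap
      (Q.blockDuality K A τ σ κ hτ hcard hros hσ hκ s (Q.betaBlockEquiv K A τ σ β κ hτ hcard hros hσ hκ hβF hb hβ2 s x))
  rw [Q.betaBlockEquiv_restrictBlockEquiv K A τ σ β κ hτ hcard hros hσ hκ hβF hb hβ2 hβ hγ,
    Q.blockDuality_restrictBlockEquiv K A τ σ κ hτ hcard hros hσ hκ hγ]

/-! ## §3 With `S(H)(K) ≃* ∏_{s ∈ Φ} Aut(V_{K,τₛ}, B_{τₛ})`: the whole group `Aut(V_{σ₁}, φ_{2,σ₁})` acts on `V_{σ₂}` by the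
contragredient of its standard representation, and `β_K⁻¹` carries that action back to the standard one -/

section Twisted

variable (hgen : Algebra.adjoin ℚ (insert β (Set.range A.ι)) = H.endAlg)

omit [Fintype S] [Module.Finite ℚ V] in
include hgen in
/-- `β ∈ E_φ` when `E_φ` is generated by `ι(F)` and `β` (plumbing). [cite: Milne1999LefschetzClasses, §2 p. 649 L57 ("E = L·1 ⊕ L·β")] -/
theorem mem_endAlg_of_adjoin_eq : β ∈ H.endAlg := by
  rw [← hgen]; exact Algebra.subset_adjoin (Set.mem_insert β _)

/-- Dictionary: `γ|V_{K,τₛ}` IS the `s`-component of the seat's `S(H)(K) ≃* ∏_{s ∈ Φ} Aut(V_{K,τₛ}, B_{τₛ})` (both are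
restriction). [cite: Milne1999LefschetzClasses, §2 p. 650 L20 ("γ ↦ γ|V_{σ₁} identifies U(φ_{1,σ}) ∩ Sp(φ_{2,σ}) with Sp(φ_{2,σ₁})")] -/
theorem Polarization.restrictBlockEquiv_eq_coe_lefschetzGroupBaseChangeEquivTwistedBlocks (γ : Q.lefschetzGroupBaseChange K)
    (s : Φ) :
    Q.restrictBlockEquiv K A γ.2 (τ s) =
      ((Q.lefschetzGroupBaseChangeEquivTwistedBlocks K A τ σ β κ Φ hτ hcard hros hσ hκ hΦ₁ hΦ₂ hβF hb hβ2 hgen γ s :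
        MatrixAlgAction.isometryCentralizer (L := K) (W := A.eigenspaceBaseChange K (τ s))
          (∅ : Set (Module.End K (A.eigenspaceBaseChange K (τ s)))) (Q.twistedBlockForm K A β (τ s))) :
        A.eigenspaceBaseChange K (τ s) ≃ₗ[K] A.eigenspaceBaseChange K (τ s)) :=
  LinearEquiv.ext fun x => Subtype.ext (by
    rw [Q.coe_restrictBlockEquiv_apply K A γ.2,
      Q.coe_lefschetzGroupBaseChangeEquivTwistedBlocks_apply K A τ σ β κ Φ hτ hcard hros hσ hκ hΦ₁ hΦ₂ hβF hb hβ2 hgen])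

/-- **Milne: "its representation on `V_{σ₂}` is the contragredient of the standard representation"** for the WHOLE group
`Aut(V_{σ₁}, φ_{2,σ₁})` on `K`-points: for an arbitrary family `g ∈ ∏_{s ∈ Φ} Aut(V_{K,τₛ}, B_{τₛ})`, the unique `γ ∈ S(H)(K)` with
blocks `g` acts on `V_{K,τₛ∘σ} ≅ V_{K,τₛ}^∨` (g23-#1's `blockDuality`) by `ᵗ(g_s)⁻¹`.
[cite: Milne1999LefschetzClasses, §2 p. 650 L33–L36 (type II) and L60–L62 (type III)] -/
theorem Polarization.blockDuality_restrictBlockEquiv_symm_twisted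
    (g : ∀ s : Φ, MatrixAlgAction.isometryCentralizer (L := K) (W := A.eigenspaceBaseChange K (τ s))
      (∅ : Set (Module.End K (A.eigenspaceBaseChange K (τ s)))) (Q.twistedBlockForm K A β (τ s)))
    (s : Φ) (y : A.eigenspaceBaseChange K ((τ (s : S)).comp (σ : F →ₐ[ℚ] F))) :
    Q.blockDuality K A τ σ κ hτ hcard hros hσ hκ s
        (Q.restrictBlockEquiv K A
          ((Q.lefschetzGroupBaseChangeEquivTwistedBlocks K A τ σ β κ Φ hτ hcard hros hσ hκ hΦ₁ hΦ₂ hβF hb hβ2 hgen).symm g).2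
          ((τ (s : S)).comp (σ : F →ₐ[ℚ] F)) y) =
      ((g s : MatrixAlgAction.isometryCentralizer (L := K) (W := A.eigenspaceBaseChange K (τ s))
          (∅ : Set (Module.End K (A.eigenspaceBaseChange K (τ s)))) (Q.twistedBlockForm K A β (τ s))) :
          A.eigenspaceBaseChange K (τ s) ≃ₗ[K] A.eigenspaceBaseChange K (τ s)).symm.dualMap
        (Q.blockDuality K A τ σ κ hτ hcard hros hσ hκ s y) := by
  rw [Q.blockDuality_restrictBlockEquiv K A τ σ κ hτ hcard hros hσ hκ,
    Q.restrictBlockEquiv_eq_coe_lefschetzGroupBaseChangeEquivTwistedBlocks K A τ σ β κ Φ hτ hcard hros hσ hκ hΦ₁ hΦ₂ hβF hb hβ2 hgen,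
    MulEquiv.apply_symm_apply]

/-- **Milne: "(which is isomorphic to the standard representation)"**: transporting that action along `β_K⁻¹ : V_{K,τₛ∘σ} ⥲ V_{K,τₛ}`
gives back the STANDARD action `g_s` — for an arbitrary `g ∈ ∏_{s ∈ Φ} Aut(V_{K,τₛ}, B_{τₛ})` and the `γ ∈ S(H)(K)` restricting to it,
`β_K⁻¹ (γ y) = g_s (β_K⁻¹ y)` on `V_{K,τₛ∘σ}`. [cite: Milne1999LefschetzClasses, §2 p. 650 L33–L36 (type II) and L60–L62 (type III)] -/
theorem Polarization.betaBlockEquiv_symm_restrictBlockEquiv_symm_twisted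
    (g : ∀ s : Φ, MatrixAlgAction.isometryCentralizer (L := K) (W := A.eigenspaceBaseChange K (τ s))
      (∅ : Set (Module.End K (A.eigenspaceBaseChange K (τ s)))) (Q.twistedBlockForm K A β (τ s)))
    (s : Φ) (y : A.eigenspaceBaseChange K ((τ (s : S)).comp (σ : F →ₐ[ℚ] F))) :
    (Q.betaBlockEquiv K A τ σ β κ hτ hcard hros hσ hκ hβF hb hβ2 s).symm
        (Q.restrictBlockEquiv K A
          ((Q.lefschetzGroupBaseChangeEquivTwistedBlocks K A τ σ β κ Φ hτ hcard hros hσ hκ hΦ₁ hΦ₂ hβF hb hβ2 hgen).symm g).2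
          ((τ (s : S)).comp (σ : F →ₐ[ℚ] F)) y) =
      ((g s : MatrixAlgAction.isometryCentralizer (L := K) (W := A.eigenspaceBaseChange K (τ s))
          (∅ : Set (Module.End K (A.eigenspaceBaseChange K (τ s)))) (Q.twistedBlockForm K A β (τ s))) :
          A.eigenspaceBaseChange K (τ s) ≃ₗ[K] A.eigenspaceBaseChange K (τ s))
        ((Q.betaBlockEquiv K A τ σ β κ hτ hcard hros hσ hκ hβF hb hβ2 s).symm y) := by
  rw [Q.betaBlockEquiv_symm_restrictBlockEquiv K A τ σ β κ hτ hcard hros hσ hκ hβF hb hβ2 (mem_endAlg_of_adjoin_eq A β hgen),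
    Q.restrictBlockEquiv_eq_coe_lefschetzGroupBaseChangeEquivTwistedBlocks K A τ σ β κ Φ hτ hcard hros hσ hκ hΦ₁ hΦ₂ hβF hb hβ2 hgen,
    MulEquiv.apply_symm_apply]

/-- **The three representations of `Aut(V_{σ₁}, φ_{2,σ₁})` agree**: for an arbitrary `g ∈ ∏_{s ∈ Φ} Aut(V_{K,τₛ}, B_{τₛ})`, the
`B_{τₛ}`-duality carries the standard action `g_s` on `V_{K,τₛ}` to the contragredient `ᵗ(g_s)⁻¹` on `V_{K,τₛ}^∨` — Milne's
parenthetical "(which is isomorphic to the standard representation)" for the whole group.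
[cite: Milne1999LefschetzClasses, §2 p. 650 L33–L36 (type II) and L60–L62 (type III)] -/
theorem Polarization.twistedBlockDuality_twisted
    (g : ∀ s : Φ, MatrixAlgAction.isometryCentralizer (L := K) (W := A.eigenspaceBaseChange K (τ s))
      (∅ : Set (Module.End K (A.eigenspaceBaseChange K (τ s)))) (Q.twistedBlockForm K A β (τ s)))
    (s : Φ) (x : A.eigenspaceBaseChange K (τ (s : S))) :
    Q.twistedBlockDuality K A τ σ β κ hτ hcard hros hσ hκ hβF hb hβ2 s
        (((g s : MatrixAlgAction.isometryCentralizer (L := K) (W := A.eigenspaceBaseChange K (τ s))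
          (∅ : Set (Module.End K (A.eigenspaceBaseChange K (τ s)))) (Q.twistedBlockForm K A β (τ s))) :
          A.eigenspaceBaseChange K (τ s) ≃ₗ[K] A.eigenspaceBaseChange K (τ s)) x) =
      ((g s : MatrixAlgAction.isometryCentralizer (L := K) (W := A.eigenspaceBaseChange K (τ s))
          (∅ : Set (Module.End K (A.eigenspaceBaseChange K (τ s)))) (Q.twistedBlockForm K A β (τ s))) :
          A.eigenspaceBaseChange K (τ s) ≃ₗ[K] A.eigenspaceBaseChange K (τ s)).symm.dualMap
        (Q.twistedBlockDuality K A τ σ β κ hτ hcard hros hσ hκ hβF hb hβ2 s x) :=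
  Q.twistedBlockDuality_apply_of_mem_isometryCentralizer K A τ σ β κ hτ hcard hros hσ hκ hβF hb hβ2 s (g s).2 x

end Twisted

end HodgeStructure

end Literature.AlgebraicGeometry.Motives
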